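import Mathlib.LinearAlgebra.Matrix.Rank
import Mathlib.LinearAlgebra.Matrix.Kronecker
import Mathlib.LinearAlgebra.Projection
import Mathlib.LinearAlgebra.Basis.VectorSpace
import Mathlib.LinearAlgebra.FiniteDimensional.Lemmas
import HarnessLib

/-!
# Non-commutative rank of a matrix space (shrunk-subspace form) and tensor blow-ups

Sources.
* [BJP18] M. Bläser, G. Jindal, A. Pandey, *A deterministic PTAS for the commutative rank of matrix
  spaces*, Theory of Computing 14 (2018), §2 Defs 2.1–2.5, Lemma 2.6 (p. 5;
  `lit read paper:doi-10-4086-toc-2018-v014a003 --pages 5`). Bib key `BlaeserJindalPandey2018`.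
* [IQS18] G. Ivanyos, Y. Qiao, K. V. Subrahmanyam, *Constructive non-commutative rank computation is
  in deterministic polynomial time*, comput. complexity 27 (2018) = arXiv:1512.03531, p. 3 (shrunk
  subspaces and their blow-ups). Bib key `IvanyosQiaoSubrahmanyam2018`.
* [FR04] M. Fortin, C. Reutenauer, Sém. Lothar. Combin. 52 (2004) B52f, Thm 1: the shrunk-subspace
  number IS the rank of `∑ xᵢ Bᵢ` over the free skew field (Cohn). Bib key `FortinReutenauer2004`.
* [DM16] H. Derksen, V. Makam, *On non-commutative rank and tensor rank*, Linear Multilinear Algebra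
  66 (2018) = arXiv:1606.06701, Def 1.5 (blow-up), Lemma 1.8 (p. 3), Cor 4.7 (p. 9). Bib key
  `DerksenMakam2018`.

Content.
1. `imageSubspace`, `IsShrunkSubspace`, `shrunkCost`, `ncRank` — the non-commutative rank of a space
   of matrices in the shrunk-subspace form of [BJP18, Def 2.3–2.5] / [IQS18] (square spaces:
   verbatim; the same cover formula `min_V (codim V + dim 𝓑V)` is used for spaces of `ι × κ`
   matrices). The identification with the rank over the free skew field `F⦓x⦔` ([FR04, Thm 1]) is
   NOT formalized — the tree has no free skew field; everything here is about the shrunk-subspace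
   quantity, which is what [BJP18], [IQS18] and [DM16, Lemma 1.8] compute. PROVED: the minimum is
   attained, the cover form, `rk(B) ≤ ncrk(𝓑)` ([BJP18, Lemma 2.6]), `ncrk ≤ #rows, #columns`,
   invariance under linear span and under relabelling rows/columns, [BJP18, Def 2.5]'s
   "`n −` largest shrinkage" reading (`exists_isShrunkSubspace_iff`).
2. `blowUp` ([DM16, Def 1.5]) and the easy half of [DM16, Lemma 1.8] (= [IQS18, p. 3]: shrunk
   subspaces blow up): every member of the square blow-up `𝓑^{(d)}` has rank `≤ d · ncrk(𝓑)`; hence a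
   full-rank member of a blow-up certifies full non-commutative rank (`ncRank_eq_card_of_mem_blowUp`,
   the mechanism of [DM16, Cor 4.7]).
Not here: the free skew field; the hard half `ncrk = max_d rk(𝒳^{(d)})/d` of [DM16, Lemma 1.8]
(regularity / blow-up algorithms of [IQS18]); [BJP18, Thm 2.7] `ncrk ≤ 2 rk` is derived in
`DM16NonCommutativeRank.lean` from [EGOW18, Lemma 3.3]. Used by
`Literature/Computability/AlgebraicComplexity/DM16NonCommutativeRank.lean` ([DM16, §4], [EGOW18, §6]).
-/

namespace Literature.Computability.AlgebraicComplexity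

/-! ## 1. Non-commutative rank in shrunk-subspace form ([BJP18, §2], [IQS18], [DM16, §1.1–1.2]) -/

section NcRank

variable {F : Type*} [Field F] {ι κ : Type*}

/-- **[BJP18, Def 2.3] image of a vector space under a matrix space**: `𝓑(V) := span ⋃_{B ∈ 𝓑} B(V)`
(for a SET of matrices `𝓑 ⊆ F^{ι × κ}` acting on column vectors `V ≤ F^κ`).
[cite: BlaeserJindalPandey2018, Def 2.3, p. 5] locator: paper:doi-10-4086-toc-2018-v014a003 p0005.txt:L13 -/
def imageSubspace [Fintype κ] (𝓑 : Set (Matrix ι κ F)) (V : Submodule F (κ → F)) :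
    Submodule F (ι → F) :=
  Submodule.span F {w | ∃ B ∈ 𝓑, ∃ v ∈ V, B.mulVec v = w}

/-- **[BJP18, Def 2.4] `c`-shrunk subspace**: `V ≤ F^κ` is a `c`-shrunk subspace of `𝓑` if
`dim 𝓑(V) ≤ dim V − c` (written additively: `dim 𝓑(V) + c ≤ dim V`; [IQS18]: "`dim 𝓑(V) ≤ dim V − s`").
[cite: BlaeserJindalPandey2018, Def 2.4, p. 5] locator: paper:doi-10-4086-toc-2018-v014a003 p0005.txt:L17 -/
def IsShrunkSubspace [Fintype κ] (𝓑 : Set (Matrix ι κ F)) (c : ℕ) (V : Submodule F (κ → F)) : Prop :=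
  Module.finrank F (imageSubspace 𝓑 V) + c ≤ Module.finrank F V

/-- The cost `codim V + dim 𝓑(V)` of the subspace `V` for the matrix space `𝓑` (the quantity
minimised in [BJP18, Def 2.5] / [FR04, Thm 1]: `n − (dim V − dim 𝓑V)`).
[cite: BlaeserJindalPandey2018, Def 2.5, p. 5] locator: paper:doi-10-4086-toc-2018-v014a003 p0005.txt:L19 -/
noncomputable def shrunkCost [Fintype κ] (𝓑 : Set (Matrix ι κ F)) (V : Submodule F (κ → F)) : ℕ :=
  Module.finrank F ((κ → F) ⧸ V) + Module.finrank F (imageSubspace 𝓑 V)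

/-- **Non-commutative rank of a matrix space, shrunk-subspace form** ([BJP18, Def 2.5]: for
`𝓑 ≤ F^{n×n}`, `nc-rank(𝓑) = n − r` with `r` the largest integer such that `𝓑` has an `r`-shrunk
subspace; equivalently `ncrk(𝓑) = min_{V ≤ F^κ} (codim V + dim 𝓑(V))`, the form used here for spaces of
`ι × κ` matrices). By [FR04, Thm 1] (Cohn) this number is the rank of the linear matrix `∑ᵢ xᵢ Bᵢ`
over the free skew field — that identification is not formalized in this tree; [DM16, Lemma 1.8]
(= [IQS18]) expresses the same number through ranks of blow-ups (easy half: `rank_le_card_mul_ncRank_of_mem_blowUp`).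
[cite: BlaeserJindalPandey2018, Def 2.5, p. 5] locator: paper:doi-10-4086-toc-2018-v014a003 p0005.txt:L19 -/
noncomputable def ncRank [Fintype κ] (𝓑 : Set (Matrix ι κ F)) : ℕ :=
  sInf (Set.range (shrunkCost 𝓑))

variable [Fintype κ]

/-- `B(V) ≤ 𝓑(V)` for `B ∈ 𝓑`. [cite: BlaeserJindalPandey2018, Def 2.3, p. 5] locator: paper:doi-10-4086-toc-2018-v014a003 p0005.txt:L13 -/
theorem map_mulVecLin_le_imageSubspace {𝓑 : Set (Matrix ι κ F)} {B : Matrix ι κ F} (hB : B ∈ 𝓑)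
    (V : Submodule F (κ → F)) : V.map B.mulVecLin ≤ imageSubspace 𝓑 V := by
  rintro _ ⟨v, hv, rfl⟩
  exact Submodule.subset_span ⟨B, hB, v, hv, rfl⟩

/-- `𝓑(V) ≤ U` iff every `B ∈ 𝓑` maps `V` into `U` (the "cover" reading of a shrunk subspace).
[cite: BlaeserJindalPandey2018, Def 2.3, p. 5] locator: paper:doi-10-4086-toc-2018-v014a003 p0005.txt:L13 -/
theorem imageSubspace_le_iff {𝓑 : Set (Matrix ι κ F)} {V : Submodule F (κ → F)}
    {U : Submodule F (ι → F)} : imageSubspace 𝓑 V ≤ U ↔ ∀ B ∈ 𝓑, V.map B.mulVecLin ≤ U := by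
  constructor
  · exact fun h B hB => (map_mulVecLin_le_imageSubspace hB V).trans h
  · intro h
    refine Submodule.span_le.2 ?_
    rintro _ ⟨B, hB, v, hv, rfl⟩
    exact h B hB ⟨v, hv, rfl⟩

/-- `𝓑(V)` is monotone in `𝓑` and in `V`. [cite: BlaeserJindalPandey2018, Def 2.3, p. 5] locator: paper:doi-10-4086-toc-2018-v014a003 p0005.txt:L13 -/
theorem imageSubspace_mono {𝓑 𝓑' : Set (Matrix ι κ F)} (h : 𝓑 ⊆ 𝓑') {V V' : Submodule F (κ → F)}
    (hV : V ≤ V') : imageSubspace 𝓑 V ≤ imageSubspace 𝓑' V' :=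
  Submodule.span_mono fun _ ⟨B, hB, v, hv, hw⟩ => ⟨B, h hB, v, hV hv, hw⟩

/-- Passing to the linear span of the matrices does not change `𝓑(V)`.
[cite: BlaeserJindalPandey2018, Def 2.1/2.3, p. 5] locator: paper:doi-10-4086-toc-2018-v014a003 p0005.txt:L3 -/
theorem imageSubspace_span (𝓑 : Set (Matrix ι κ F)) (V : Submodule F (κ → F)) :
    imageSubspace (Submodule.span F 𝓑 : Set (Matrix ι κ F)) V = imageSubspace 𝓑 V := by
  refine le_antisymm ?_ (imageSubspace_mono Submodule.subset_span le_rfl)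
  rw [imageSubspace_le_iff]
  intro B hB
  induction hB using Submodule.span_induction with
  | mem B hB => exact map_mulVecLin_le_imageSubspace hB V
  | zero =>
    rintro _ ⟨v, -, rfl⟩
    simp
  | add B B' _ _ h h' =>
    rintro _ ⟨v, hv, rfl⟩
    simpa [Matrix.add_mulVec] using add_mem (h ⟨v, hv, rfl⟩) (h' ⟨v, hv, rfl⟩)
  | smul a B _ h =>
    rintro _ ⟨v, hv, rfl⟩
    simpa [Matrix.smul_mulVec] using Submodule.smul_mem _ a (h ⟨v, hv, rfl⟩)

/-- `𝓑(⊥) = ⊥`. [cite: BlaeserJindalPandey2018, Def 2.3, p. 5] locator: paper:doi-10-4086-toc-2018-v014a003 p0005.txt:L13 -/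
theorem imageSubspace_bot (𝓑 : Set (Matrix ι κ F)) : imageSubspace 𝓑 (⊥ : Submodule F (κ → F)) = ⊥ := by
  refine (Submodule.span_eq_bot).2 ?_
  rintro _ ⟨B, -, v, hv, rfl⟩
  rw [(Submodule.mem_bot F).1 hv, Matrix.mulVec_zero]

/-- `𝓑(V)` is finite-dimensional, of dimension `≤ |ι|`. [cite: BlaeserJindalPandey2018, Def 2.3, p. 5] locator: paper:doi-10-4086-toc-2018-v014a003 p0005.txt:L13 -/
theorem finrank_imageSubspace_le_card [Fintype ι] (𝓑 : Set (Matrix ι κ F)) (V : Submodule F (κ → F)) :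
    Module.finrank F (imageSubspace 𝓑 V) ≤ Fintype.card ι :=
  (Submodule.finrank_le _).trans (Module.finrank_fintype_fun_eq_card F).le

/-- The infimum defining `ncRank` is attained by some subspace `V`.
[cite: BlaeserJindalPandey2018, Def 2.5, p. 5] locator: paper:doi-10-4086-toc-2018-v014a003 p0005.txt:L19 -/
theorem exists_shrunkCost_eq_ncRank (𝓑 : Set (Matrix ι κ F)) :
    ∃ V : Submodule F (κ → F), shrunkCost 𝓑 V = ncRank 𝓑 :=
  Nat.sInf_mem (Set.range_nonempty (shrunkCost 𝓑))

/-- Every subspace bounds `ncRank` by its cost `codim V + dim 𝓑(V)`.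
[cite: BlaeserJindalPandey2018, Def 2.5, p. 5] locator: paper:doi-10-4086-toc-2018-v014a003 p0005.txt:L19 -/
theorem ncRank_le_shrunkCost (𝓑 : Set (Matrix ι κ F)) (V : Submodule F (κ → F)) :
    ncRank 𝓑 ≤ shrunkCost 𝓑 V :=
  Nat.sInf_le ⟨V, rfl⟩

/-- **Cover form**: if every `B ∈ 𝓑` maps `W` into `U`, then `ncrk(𝓑) ≤ codim W + dim U`
(the pair `(U, W)` is a zero block of the space after a change of bases, [FR04, Thm 1]).
[cite: BlaeserJindalPandey2018, Def 2.5, p. 5] locator: paper:doi-10-4086-toc-2018-v014a003 p0005.txt:L19 -/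
theorem ncRank_le_of_cover (𝓑 : Set (Matrix ι κ F)) (U : Submodule F (ι → F))
    (W : Submodule F (κ → F)) [FiniteDimensional F U] (h : ∀ B ∈ 𝓑, W.map B.mulVecLin ≤ U) :
    ncRank 𝓑 ≤ Module.finrank F ((κ → F) ⧸ W) + Module.finrank F U :=
  (ncRank_le_shrunkCost 𝓑 W).trans
    (Nat.add_le_add_left (Submodule.finrank_mono (imageSubspace_le_iff.2 h)) _)

/-- **Cover form, attained**: some pair `(U, W)` with `B(W) ≤ U` for all `B ∈ 𝓑` has
`codim W + dim U = ncrk(𝓑)`. [cite: BlaeserJindalPandey2018, Def 2.5, p. 5] locator: paper:doi-10-4086-toc-2018-v014a003 p0005.txt:L19 -/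
theorem exists_cover_eq_ncRank (𝓑 : Set (Matrix ι κ F)) :
    ∃ (U : Submodule F (ι → F)) (W : Submodule F (κ → F)), (∀ B ∈ 𝓑, W.map B.mulVecLin ≤ U) ∧
      Module.finrank F ((κ → F) ⧸ W) + Module.finrank F U = ncRank 𝓑 := by
  obtain ⟨W, hW⟩ := exists_shrunkCost_eq_ncRank 𝓑
  exact ⟨imageSubspace 𝓑 W, W, fun B hB => map_mulVecLin_le_imageSubspace hB W, hW⟩

/-- `ncrk(𝓑) ≤ #columns` (take `V = ⊥`). [cite: BlaeserJindalPandey2018, Def 2.5, p. 5] locator: paper:doi-10-4086-toc-2018-v014a003 p0005.txt:L19 -/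
theorem ncRank_le_card_cols (𝓑 : Set (Matrix ι κ F)) : ncRank 𝓑 ≤ Fintype.card κ := by
  refine (ncRank_le_shrunkCost 𝓑 ⊥).trans (le_of_eq ?_)
  rw [shrunkCost, imageSubspace_bot, finrank_bot, add_zero, ← Module.finrank_fintype_fun_eq_card F]
  exact (Submodule.quotEquivOfEqBot (⊥ : Submodule F (κ → F)) rfl).finrank_eq

/-- `ncrk(𝓑) ≤ #rows` (take `V = ⊤`). [cite: BlaeserJindalPandey2018, Def 2.5, p. 5] locator: paper:doi-10-4086-toc-2018-v014a003 p0005.txt:L19 -/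
theorem ncRank_le_card_rows [Fintype ι] (𝓑 : Set (Matrix ι κ F)) : ncRank 𝓑 ≤ Fintype.card ι := by
  refine (ncRank_le_shrunkCost 𝓑 ⊤).trans ?_
  rw [shrunkCost]
  have h0 : Module.finrank F ((κ → F) ⧸ (⊤ : Submodule F (κ → F))) = 0 :=
    Module.finrank_zero_of_subsingleton
  rw [h0, zero_add]
  exact finrank_imageSubspace_le_card 𝓑 ⊤

/-- `ncRank` is monotone in the matrix space. [cite: BlaeserJindalPandey2018, Def 2.5, p. 5] locator: paper:doi-10-4086-toc-2018-v014a003 p0005.txt:L19 -/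
theorem ncRank_mono [Fintype ι] {𝓑 𝓑' : Set (Matrix ι κ F)} (h : 𝓑 ⊆ 𝓑') : ncRank 𝓑 ≤ ncRank 𝓑' := by
  obtain ⟨V, hV⟩ := exists_shrunkCost_eq_ncRank 𝓑'
  rw [← hV]
  exact (ncRank_le_shrunkCost 𝓑 V).trans
    (Nat.add_le_add_left (Submodule.finrank_mono (imageSubspace_mono h le_rfl)) _)

/-- `ncrk(span 𝓑) = ncrk(𝓑)`: the non-commutative rank depends only on the matrix SPACE
([BJP18, Def 2.1]). [cite: BlaeserJindalPandey2018, Def 2.1/2.5, p. 5] locator: paper:doi-10-4086-toc-2018-v014a003 p0005.txt:L3 -/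
theorem ncRank_span (𝓑 : Set (Matrix ι κ F)) :
    ncRank (Submodule.span F 𝓑 : Set (Matrix ι κ F)) = ncRank 𝓑 := by
  have h : shrunkCost (Submodule.span F 𝓑 : Set (Matrix ι κ F)) = shrunkCost 𝓑 := by
    funext V
    rw [shrunkCost, shrunkCost, imageSubspace_span]
  rw [ncRank, ncRank, h]

/-- The rank of a single matrix is bounded by `codim W + dim B(W)` for every `W` (split
`F^κ = W ⊕ W'`). [cite: BlaeserJindalPandey2018, Lemma 2.6 (proof), p. 5] locator: paper:doi-10-4086-toc-2018-v014a003 p0005.txt:L27 -/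
theorem rank_le_finrank_quotient_add_finrank_map (B : Matrix ι κ F) (W : Submodule F (κ → F)) :
    B.rank ≤ Module.finrank F ((κ → F) ⧸ W) + Module.finrank F (W.map B.mulVecLin) := by
  obtain ⟨W', hWW'⟩ := Submodule.exists_isCompl W
  have htop : LinearMap.range B.mulVecLin = W.map B.mulVecLin ⊔ W'.map B.mulVecLin := by
    rw [LinearMap.range_eq_map, ← hWW'.sup_eq_top, Submodule.map_sup]
  have hq : Module.finrank F ((κ → F) ⧸ W) = Module.finrank F W' :=
    (Submodule.quotientEquivOfIsCompl W W' hWW').finrank_eq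
  unfold Matrix.rank
  rw [htop, hq, add_comm]
  exact (Submodule.finrank_add_le_finrank_add_finrank _ _).trans
    (Nat.add_le_add_left (Submodule.finrank_map_le _ _) _)

/-- **[BJP18, Lemma 2.6]: `rk(B) ≤ nc-rank(𝓑)` for every `B ∈ 𝓑`** (all fields).
[cite: BlaeserJindalPandey2018, Lemma 2.6, p. 5] locator: paper:doi-10-4086-toc-2018-v014a003 p0005.txt:L25 -/
theorem rank_le_ncRank [Fintype ι] {𝓑 : Set (Matrix ι κ F)} {B : Matrix ι κ F} (hB : B ∈ 𝓑) :
    B.rank ≤ ncRank 𝓑 := by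
  obtain ⟨V, hV⟩ := exists_shrunkCost_eq_ncRank 𝓑
  rw [← hV]
  exact (rank_le_finrank_quotient_add_finrank_map B V).trans
    (Nat.add_le_add_left (Submodule.finrank_mono (map_mulVecLin_le_imageSubspace hB V)) _)

/-- **[BJP18, Def 2.5] as printed**: `𝓑` has a `c`-shrunk subspace iff `ncrk(𝓑) + c ≤ #columns`,
i.e. `ncrk(𝓑) = n − max{c : ∃ c-shrunk subspace}`. [cite: BlaeserJindalPandey2018, Def 2.5, p. 5] locator: paper:doi-10-4086-toc-2018-v014a003 p0005.txt:L19 -/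
theorem exists_isShrunkSubspace_iff (𝓑 : Set (Matrix ι κ F)) (c : ℕ) :
    (∃ V, IsShrunkSubspace 𝓑 c V) ↔ ncRank 𝓑 + c ≤ Fintype.card κ := by
  have key : ∀ V : Submodule F (κ → F),
      shrunkCost 𝓑 V + Module.finrank F V = Fintype.card κ + Module.finrank F (imageSubspace 𝓑 V) := by
    intro V
    rw [shrunkCost, add_right_comm, Submodule.finrank_quotient_add_finrank,
      Module.finrank_fintype_fun_eq_card]
  constructor
  · rintro ⟨V, hV⟩
    have h1 := ncRank_le_shrunkCost 𝓑 V
    have h2 := key V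
    unfold IsShrunkSubspace at hV
    omega
  · intro h
    obtain ⟨V, hV⟩ := exists_shrunkCost_eq_ncRank 𝓑
    refine ⟨V, ?_⟩
    have h2 := key V
    unfold IsShrunkSubspace
    omega

end NcRank

/-! ## 2. Tensor blow-ups ([DM16, Def 1.5]) and the easy half of [DM16, Lemma 1.8] -/

section BlowUp

variable {F : Type*} [Field F] {ι κ μ ν : Type*}

/-- **[DM16, Def 1.5] the `(p,q)` tensor blow-up** of a space of `k × n` matrices:
`𝒳^{(p,q)} := 𝒳 ⊗ M_{p,q} = {∑ᵢ Xᵢ ⊗ Tᵢ : Xᵢ ∈ 𝒳, Tᵢ ∈ M_{p,q}}`, a linear subspace of `M_{kp,nq}`; here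
for a set `𝓑` of `ι × κ` matrices and index types `μ, ν` (the paper's `p = |μ|`, `q = |ν|`), as the span
of the Kronecker products `X ⊗ₖ T` inside `Matrix (ι × μ) (κ × ν) F`; `𝒳^{(d)} = 𝒳^{(d,d)}`.
[cite: DerksenMakam2018, Def 1.5, p. 3] locator: paper:arxiv-1606.06701 p0003.txt:L62 -/
def blowUp (𝓑 : Set (Matrix ι κ F)) (μ ν : Type*) : Submodule F (Matrix (ι × μ) (κ × ν) F) :=
  Submodule.span F {M | ∃ X ∈ 𝓑, ∃ T : Matrix μ ν F, Matrix.kroneckerMap (· * ·) X T = M}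

/-- The subspace `W ⊗ F^ν ≤ F^{κ × ν}` of vectors all of whose `ν`-slices lie in `W` (the blown-up
shrunk subspace of [IQS18, p. 3]: "by a square `d`-blow-up, `s`-shrunk subspaces are blown up to
`ds`-shrunk subspaces"). [cite: IvanyosQiaoSubrahmanyam2018, §1, p. 3] locator: paper:arxiv-1512.03531 p0003.txt:L64 -/
def sliceSubmodule (W : Submodule F (κ → F)) (ν : Type*) : Submodule F (κ × ν → F) where
  carrier := {f | ∀ j : ν, (fun k => f (k, j)) ∈ W}
  add_mem' := fun {f g} hf hg j => by simpa [Pi.add_def] using W.add_mem (hf j) (hg j)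
  zero_mem' := fun j => by exact W.zero_mem
  smul_mem' := fun c {f} hf j => by simpa [Pi.smul_def] using W.smul_mem c (hf j)

/-- Membership in `W ⊗ F^ν`: every slice lies in `W`. [cite: IvanyosQiaoSubrahmanyam2018, §1, p. 3] locator: paper:arxiv-1512.03531 p0003.txt:L64 -/
theorem mem_sliceSubmodule {W : Submodule F (κ → F)} {f : κ × ν → F} :
    f ∈ sliceSubmodule W ν ↔ ∀ j : ν, (fun k => f (k, j)) ∈ W :=
  Iff.rfl

/-- `W ⊗ F^ν ≃ (ν → W)`. [cite: IvanyosQiaoSubrahmanyam2018, §1, p. 3] locator: paper:arxiv-1512.03531 p0003.txt:L64 -/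
def sliceEquiv (W : Submodule F (κ → F)) (ν : Type*) : sliceSubmodule W ν ≃ₗ[F] (ν → W) where
  toFun f j := ⟨fun k => (f : κ × ν → F) (k, j), f.2 j⟩
  map_add' f g := by ext; rfl
  map_smul' c f := by ext; rfl
  invFun g := ⟨fun kj => (g kj.2 : κ → F) kj.1, fun j => (g j).2⟩
  left_inv f := by ext ⟨k, j⟩; rfl
  right_inv g := by ext; rfl

/-- `dim (W ⊗ F^ν) = |ν| · dim W`. [cite: IvanyosQiaoSubrahmanyam2018, §1, p. 3] locator: paper:arxiv-1512.03531 p0003.txt:L64 -/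
theorem finrank_sliceSubmodule [Fintype κ] [Fintype ν] (W : Submodule F (κ → F)) :
    Module.finrank F (sliceSubmodule W ν) = Fintype.card ν * Module.finrank F W := by
  rw [(sliceEquiv W ν).finrank_eq, Module.finrank_pi_fintype, Finset.sum_const, Finset.card_univ,
    smul_eq_mul]

/-- `codim (W ⊗ F^ν) = |ν| · codim W`. [cite: IvanyosQiaoSubrahmanyam2018, §1, p. 3] locator: paper:arxiv-1512.03531 p0003.txt:L64 -/
theorem finrank_quotient_sliceSubmodule [Fintype κ] [Fintype ν] (W : Submodule F (κ → F)) :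
    Module.finrank F ((κ × ν → F) ⧸ sliceSubmodule W ν) =
      Fintype.card ν * Module.finrank F ((κ → F) ⧸ W) := by
  have h1 := Submodule.finrank_quotient_add_finrank (sliceSubmodule W ν)
  rw [finrank_sliceSubmodule, Module.finrank_fintype_fun_eq_card, Fintype.card_prod] at h1
  have h2 := Submodule.finrank_quotient_add_finrank W
  rw [Module.finrank_fintype_fun_eq_card] at h2
  have h3 : Fintype.card ν * Module.finrank F ((κ → F) ⧸ W) + Fintype.card ν * Module.finrank F W =
      Fintype.card κ * Fintype.card ν := by
    rw [← mul_add, h2, mul_comm]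
  omega

/-- A slice of `(X ⊗ₖ T) · f` is a combination of the vectors `X · (slices of f)`.
[cite: DerksenMakam2018, Def 1.5, p. 3] locator: paper:arxiv-1606.06701 p0003.txt:L62 -/
theorem kronecker_mulVec_apply [Fintype κ] [Fintype ν] (X : Matrix ι κ F) (T : Matrix μ ν F)
    (f : κ × ν → F) (i : ι) (i' : μ) :
    (Matrix.kroneckerMap (· * ·) X T).mulVec f (i, i') =
      ∑ j, T i' j * X.mulVec (fun k => f (k, j)) i := by
  simp only [Matrix.mulVec, dotProduct, Matrix.kroneckerMap_apply, Fintype.sum_prod_type,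
    Finset.mul_sum]
  rw [Finset.sum_comm]
  exact Finset.sum_congr rfl fun j _ => Finset.sum_congr rfl fun k _ => by ring

/-- **Shrunk subspaces blow up** ([IQS18, p. 3]): if every `B ∈ 𝓑` maps `W` into `U`, then every
member of the blow-up `𝓑^{(μ,ν)}` maps `W ⊗ F^ν` into `U ⊗ F^μ`.
[cite: IvanyosQiaoSubrahmanyam2018, §1, p. 3] locator: paper:arxiv-1512.03531 p0003.txt:L64 -/
theorem mulVec_mem_sliceSubmodule_of_mem_blowUp [Fintype κ] [Fintype ν] {𝓑 : Set (Matrix ι κ F)}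
    {U : Submodule F (ι → F)} {W : Submodule F (κ → F)} (hUW : ∀ B ∈ 𝓑, W.map B.mulVecLin ≤ U)
    {M : Matrix (ι × μ) (κ × ν) F} (hM : M ∈ blowUp 𝓑 μ ν) {f : κ × ν → F}
    (hf : f ∈ sliceSubmodule W ν) : M.mulVec f ∈ sliceSubmodule U μ := by
  induction hM using Submodule.span_induction with
  | mem M hM =>
    obtain ⟨X, hX, T, rfl⟩ := hM
    intro i'
    have : (fun i => (Matrix.kroneckerMap (· * ·) X T).mulVec f (i, i')) =
        ∑ j, T i' j • X.mulVec (fun k => f (k, j)) := by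
      funext i
      rw [kronecker_mulVec_apply, Finset.sum_apply]
      simp [Pi.smul_apply, smul_eq_mul]
    rw [this]
    exact U.sum_mem fun j _ => U.smul_mem _ (hUW X hX ⟨_, hf j, rfl⟩)
  | zero => intro i'; rw [Matrix.zero_mulVec]; exact U.zero_mem
  | add M M' _ _ h h' =>
    intro i'
    simpa [Matrix.add_mulVec, Pi.add_def] using U.add_mem (h i') (h' i')
  | smul a M _ h =>
    intro i'
    simpa [Matrix.smul_mulVec, Pi.smul_def] using U.smul_mem a (h i')

/-- **[DM16, Lemma 1.8], easy half (= [IQS18]): `rk(M) ≤ d · ncrk(𝓑)` for every member `M` of the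
square blow-up `𝓑^{(d)}`** (`d = |μ|`; any field). The hard half — equality for some `d`, whence
`ncrk = max_d rk(𝒳^{(d)})/d = lim_d rk(𝒳^{(d)})/d` — is not formalized.
[cite: DerksenMakam2018, Lemma 1.8, p. 3] locator: paper:arxiv-1606.06701 p0003.txt:L80 -/
theorem rank_le_card_mul_ncRank_of_mem_blowUp [Fintype ι] [Fintype κ] [Fintype μ]
    {𝓑 : Set (Matrix ι κ F)} {M : Matrix (ι × μ) (κ × μ) F} (hM : M ∈ blowUp 𝓑 μ μ) :
    M.rank ≤ Fintype.card μ * ncRank 𝓑 := by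
  obtain ⟨U, W, hUW, hcost⟩ := exists_cover_eq_ncRank 𝓑
  have h1 := rank_le_finrank_quotient_add_finrank_map M (sliceSubmodule W μ)
  have h2 : Module.finrank F ((sliceSubmodule W μ).map M.mulVecLin) ≤
      Module.finrank F (sliceSubmodule U μ) :=
    Submodule.finrank_mono fun g ⟨f, hf, hg⟩ =>
      hg ▸ mulVec_mem_sliceSubmodule_of_mem_blowUp hUW hM hf
  rw [finrank_quotient_sliceSubmodule] at h1
  rw [finrank_sliceSubmodule] at h2
  calc M.rank ≤ Fintype.card μ * Module.finrank F ((κ → F) ⧸ W) +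
        Fintype.card μ * Module.finrank F U := h1.trans (Nat.add_le_add_left h2 _)
    _ = Fintype.card μ * ncRank 𝓑 := by rw [← mul_add, hcost]

/-- **Full-rank certificate (the mechanism of [DM16, Cor 4.7])**: if some member of the square
blow-up `𝓑^{(d)}` (`d = |μ| ≥ 1`) has rank `≥ d · #columns`, then `ncrk(𝓑) = #columns` is full.
[cite: DerksenMakam2018, Cor 4.7, p. 9] locator: paper:arxiv-1606.06701 p0009.txt:L77 -/
theorem ncRank_eq_card_of_mem_blowUp [Fintype ι] [Fintype κ] [Fintype μ] [Nonempty μ]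
    {𝓑 : Set (Matrix ι κ F)} {M : Matrix (ι × μ) (κ × μ) F} (hM : M ∈ blowUp 𝓑 μ μ)
    (hrank : Fintype.card μ * Fintype.card κ ≤ M.rank) : ncRank 𝓑 = Fintype.card κ :=
  le_antisymm (ncRank_le_card_cols 𝓑)
    (Nat.le_of_mul_le_mul_left (hrank.trans (rank_le_card_mul_ncRank_of_mem_blowUp hM))
      Fintype.card_pos)

end BlowUp


/-! ## 3. Relabelling rows and columns -/

section Reindex

variable {F : Type*} [Field F] {ι κ ι' κ' : Type*} [Fintype κ] [Fintype κ']

/-- Relabelling rows and columns transports `B · v`. [cite: BlaeserJindalPandey2018, Def 2.3, p. 5] locator: paper:doi-10-4086-toc-2018-v014a003 p0005.txt:L13 -/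
theorem reindex_mulVec_funCongrLeft (eι : ι ≃ ι') (eκ : κ ≃ κ') (B : Matrix ι κ F) (v : κ → F) :
    (Matrix.reindex eι eκ B).mulVec (LinearEquiv.funCongrLeft F F eκ.symm v) =
      LinearEquiv.funCongrLeft F F eι.symm (B.mulVec v) := by
  rw [Matrix.reindex_apply, Matrix.submatrix_mulVec_equiv]
  have : (LinearEquiv.funCongrLeft F F eκ.symm v) ∘ eκ.symm.symm = v := by
    funext k
    simp [LinearEquiv.funCongrLeft_apply, LinearMap.funLeft_apply]
  rw [this]
  rfl

/-- The image subspace of the relabelled space is the relabelled image subspace.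
[cite: BlaeserJindalPandey2018, Def 2.3, p. 5] locator: paper:doi-10-4086-toc-2018-v014a003 p0005.txt:L13 -/
theorem imageSubspace_image_reindex (eι : ι ≃ ι') (eκ : κ ≃ κ') (𝓑 : Set (Matrix ι κ F))
    (V : Submodule F (κ → F)) :
    imageSubspace ((Matrix.reindex eι eκ) '' 𝓑)
        (V.map (LinearEquiv.funCongrLeft F F eκ.symm : (κ → F) →ₗ[F] (κ' → F))) =
      (imageSubspace 𝓑 V).map (LinearEquiv.funCongrLeft F F eι.symm : (ι → F) →ₗ[F] (ι' → F)) := by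
  rw [imageSubspace, imageSubspace, ← Submodule.span_image]
  congr 1
  ext w'
  simp only [Set.mem_setOf_eq, Set.mem_image, Submodule.mem_map]
  constructor
  · rintro ⟨_, ⟨B, hB, rfl⟩, _, ⟨v, hv, rfl⟩, rfl⟩
    exact ⟨B.mulVec v, ⟨B, hB, v, hv, rfl⟩, (reindex_mulVec_funCongrLeft eι eκ B v).symm⟩
  · rintro ⟨_, ⟨B, hB, v, hv, rfl⟩, rfl⟩
    exact ⟨_, ⟨B, hB, rfl⟩, _, ⟨v, hv, rfl⟩, reindex_mulVec_funCongrLeft eι eκ B v⟩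

/-- **`ncRank` is invariant under relabelling rows and columns** (it is an invariant of the matrix
space up to the `GL × GL` action; here only permutations of the bases are needed).
[cite: BlaeserJindalPandey2018, Def 2.5, p. 5] locator: paper:doi-10-4086-toc-2018-v014a003 p0005.txt:L19 -/
theorem ncRank_image_reindex (eι : ι ≃ ι') (eκ : κ ≃ κ') (𝓑 : Set (Matrix ι κ F)) :
    ncRank ((Matrix.reindex eι eκ) '' 𝓑) = ncRank 𝓑 := by
  let φκ : (κ → F) ≃ₗ[F] (κ' → F) := LinearEquiv.funCongrLeft F F eκ.symm
  let φι : (ι → F) ≃ₗ[F] (ι' → F) := LinearEquiv.funCongrLeft F F eι.symm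
  have hcost : ∀ V : Submodule F (κ → F),
      shrunkCost ((Matrix.reindex eι eκ) '' 𝓑) (V.map (φκ : (κ → F) →ₗ[F] (κ' → F))) =
        shrunkCost 𝓑 V := by
    intro V
    rw [shrunkCost, shrunkCost, imageSubspace_image_reindex, LinearEquiv.finrank_map_eq]
    congr 1
    have h1 := Submodule.finrank_quotient_add_finrank (V.map (φκ : (κ → F) →ₗ[F] (κ' → F)))
    have h2 := Submodule.finrank_quotient_add_finrank V
    rw [LinearEquiv.finrank_map_eq, Module.finrank_fintype_fun_eq_card,
      ← Fintype.card_congr eκ] at h1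
    rw [Module.finrank_fintype_fun_eq_card] at h2
    omega
  have hrange : Set.range (shrunkCost ((Matrix.reindex eι eκ) '' 𝓑)) = Set.range (shrunkCost 𝓑) := by
    ext r
    constructor
    · rintro ⟨V', rfl⟩
      refine ⟨V'.map (φκ.symm : (κ' → F) →ₗ[F] (κ → F)), ?_⟩
      rw [← hcost, (Submodule.map_symm_eq_iff φκ).1 rfl]
    · rintro ⟨V, rfl⟩
      exact ⟨_, hcost V⟩
  rw [ncRank, ncRank, hrange]

end Reindex

end Literature.Computability.AlgebraicComplexity
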